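/-
COR-CM (cells pub-hodgecm / pub-hodgecm2, stage 2 of the Hodge ladder) — TRANSPOSITION item (vi), S-LANE, CARRIERS-PLAN row 9 (`hirr`): the X3-ω
CONSUMER JUNCTION.  The END display of record (POINTER LABEL #6, ✔ p328154 `…RestOneBuiltEpi.lean` :341) still displays the READING
`hirr : ∀ F … V i, (Def411WeilCarriers.rho … (OmegaMuSplitting.hsMu F ι₁ V Φ) V.adelicFinDiag… i.1.1 i.1.2).IsIrreducible` ([Liu2021] Def. 4.11 /
Lem. D.1 (1), POSITED at the display's constructed carriers).  The Literature chain F1–F9 (item6-p3) + `Liu2021/Def411IrreducibleOfLemD1AsPrinted`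
(mc-theta-3, ✔ p328125, §5 `Def411WeilCarriers.rho_isIrreducible_of_lemD1AsPrinted`) derives `(rho …).IsIrreducible` for a GENERAL pair datum from:
DATA `𝓢` (local splittings of `U(J_V ⊗ (a))(F_v)`, [GR91 Prop. 3.1.1 L1–3]) with the local–global factorisation `hfac` of the displayed splitting
through them (CARRIERS-PLAN residual (ρ1)), Step 2's local characters `μ_v` ([Liu2021] App. D §D.1 Step 2), the per-place CITE
`hD1 v : LemD1_1AsPrinted (localLemD1Data … v)` ([Liu2021] Lem. D.1 first sentence + (1), AS PRINTED; residual (ρ4)) and the survival `hS` of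
`1_{𝒪_vⁿ}` off a finite set (Def. 4.11's `⊗'`; residual (ρ3): non-split places ✔ p328454, split places ⟸ (SPH), item6-p3).  Nobody had yet
instantiated that theorem AT THE DISPLAY'S OWN CARRIERS (`N := 3`, `e := finProdFinEquiv`, `J_V := diagonal V.diagEntries` in hcomp-level's diagonal
frame, `s := OmegaMuSplitting.sMu` = the `χ_μ`-attached splitting, `ι := V.adelicFinDiag`).  THIS FILE is that ONE application: theorem
`Model.hirr_of_lemD1AsPrinted_row9` concludes, for every face datum `(F, ι₁, V, Φ)` and every `(ε, χ)`, the display's `hirr` conclusion VERBATIM from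
the four row-9 inputs typed at these carriers — so a later ω-side re-cut of the END display is `hirr := fun F _ h6 Φ ι₁ _ V i ↦
hirr_of_lemD1AsPrinted_row9 F ι₁ V Φ i.1.1 i.1.2 …` once (ρ1) `hfac` (at `𝓢 := finLocalSplittingsCM … (chiMu F ι₁ Φ)`, GR-1 file E) and the
split-place survival are tree theorems.  NOTHING is re-cut or re-posited here; no pointer moves; HC_CM is NOT proved; S2 = B01-S is NOT inhabited;
this discharges NO displayed hypothesis — it certifies in the kernel that row 9's chain REACHES the display's binder and names its inputs BY TYPE.
Seat prover-pub-hodgecm-own-htheta-g6-0 (own-htheta gen 6, S2-CRUX owner; rule-(1) blanket `Transposition/Item6*`).  ONE theorem; no definition,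
no instance, no named fact, no `variable`; nothing landed is edited (NEW leaf, FILE-ONCE).
-/
import Summits.HodgeConjecture.CorCM.B01.Transposition.Item6OmegaMuSplitting
import Literature.NumberTheory.Automorphic.Liu2021.Def411IrreducibleOfLemD1AsPrinted
import HarnessLib

set_option autoImplicit false

/-!
# The END display's `hirr`, at its own carriers, from CARRIERS-PLAN row 9's inputs (X3-ω consumer junction)

* `Model.hirr_of_lemD1AsPrinted_row9` — for a face datum `(F, ι₁, V, Φ)`, `ε : Eps F⁺ (imagUnitSq F)`, `χ : Chi F⁺ F c̄`, `a := lineOf ε`: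
  local splittings `𝓢` of `U(diag V.diagEntries ⊗ (a))` at the finite places of `F⁺` + `hfac` (the displayed `χ_μ`-attached splitting
  `OmegaMuSplitting.sMu F ι₁ V Φ a`, restricted to the finite-adelic pair, IS the reference section assembled from `𝓢`) + Step 2's `μ_v`
  (unitary, continuous, kernel on `F⁺_vˣ` = norms) + [Liu2021, Lem. D.1 (1)] AS PRINTED at `localLemD1Data … v` for every finite `v` + survival
  of `1_{𝒪_v³}` off a finite set ⟹ `(Def411WeilCarriers.rho F⁺ F c̄ 3 finProdFinEquiv (diagonal V.diagEntries) … (OmegaMuSplitting.hsMu F ι₁ V Φ)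
  V.adelicFinDiag.toMulEquiv.toMonoidHom ε χ).IsIrreducible` — ONE application of `Def411WeilCarriers.rho_isIrreducible_of_lemD1AsPrinted`
  (`hι` := `V.adelicFinDiag` is onto, `hn` := `3 ≤ 3`).
HC_CM is NOT proved.

References: Y. Liu, *Fourier–Jacobi cycles and arithmetic relative trace formula*, Camb. J. Math. 9 (2021) = arXiv:2102.11518, Def. 4.11
(FJcycle.tex l. 2090–2096), App. D §D.1 Steps 1∕2∕3 (l. 5217∕5219∕5221), Lemma D.1 (l. 5227; (1) l. 5229); S. Gelbart, J. Rogawski, Invent. Math.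
105 (1991), §3.1 Prop. 3.1.1 p. 455 L1–3, Remark p. 457; D. Flath, PSPM 33 (1979) part 1, Thm. 2 ∕ Ex. 2.
-/

noncomputable section

open scoped Matrix Kronecker TensorProduct

namespace Summit.HodgeConjecture.CorCM.Model

open NumberField IsDedekindDomain
open Literature.AlgebraicGeometry.Motives (CMType)
open Literature.NumberTheory.Automorphic Literature.NumberTheory.Automorphic.UnitaryGroup
open Literature.NumberTheory.Automorphic.Liu2021
open Literature.NumberTheory.Automorphic.Liu2021.Def411WeilCarriers (JW TW isSymm_TW isUnit_det_TW JW_eq JW_apply_ne_zero lineOf)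
open Literature.NumberTheory.GelbartRogawski1991 Literature.NumberTheory.GelbartRogawski1991.UnitaryDualPair
open Literature.NumberTheory.GelbartRogawski1991.UnitaryDualPair.WeilCoinv
open Literature.NumberTheory.Weil1964 Literature.RepresentationTheory
open Summit.HodgeConjecture.CorCM.Transposition

/-- **The END display's `hirr` at its own carriers, from CARRIERS-PLAN row 9's inputs** ([Liu2021, Def. 4.11]'s «irreducible» for
`ω(μ, ε, χ)` from Lemma D.1 (1) AS PRINTED, place by place).  Face datum `(F, ι₁, V, Φ)`; `ε`, `χ` as in the display's admissible index;
`a := lineOf ε`.  GIVEN: local splittings `𝓢` of `U(diag V.diagEntries ⊗ (a))(F⁺_v)` at every finite `v` ([GelbartRogawski1991, Prop. 3.1.1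
L1–3]; DATA); `hfac` — the displayed `χ_μ`-attached splitting `OmegaMuSplitting.sMu F ι₁ V Φ a` restricted to the finite-adelic pair
`U(diag V.diagEntries)(𝔸_f) × U(J_W)(𝔸_f)` IS the reference section `localRefSection … 𝓢` assembled from `𝓢` (local–global compatibility,
CARRIERS-PLAN (ρ1)); Step 2's characters `μ_v : (F ⊗ F⁺_v)ˣ → ℂ¹`, unitary, continuous, `μ_v|_{F⁺_vˣ}` with kernel the norms (`hμF`);
**[Liu2021, App. D Lemma D.1, first sentence + (1)] AS PRINTED** for the datum `localLemD1Data … v = (F⁺_v, F_v, U(V ⊗ ⟨a⟩)(F⁺_v), δ ⊗ 1,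
μ_v, χ_v; ω_v = 𝓢.omegaLoc v)` at EVERY finite `v` (`hD1`, a cite per place — (ρ4)); and the survival of the class of `1_{𝒪_v³}` in the
`χ_v`-quotient off a finite set (`hS`, Def. 4.11's `⊗'` — (ρ3)).  THEN the display's reading holds at `(ε, χ)`:
`(rho … (OmegaMuSplitting.hsMu F ι₁ V Φ) V.adelicFinDiag ε χ).IsIrreducible`.  One application of
`Def411WeilCarriers.rho_isIrreducible_of_lemD1AsPrinted` with `ι := V.adelicFinDiag` onto and `n = 3`.  HC_CM is NOT proved; nothing displayed
by the END display is discharged here (the inputs are hypotheses of this theorem).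
[cite: Liu2021, Def. 4.11 (l. 2090–2096), App. D §D.1 Steps 1∕2∕3 (l. 5217∕5219∕5221), Lemma D.1 (l. 5227; (1) l. 5229), arXiv:2102.11518 chunk p0056 L8–L23 (arXiv PDF p. 76)]
[cite: GelbartRogawski1991, §3.1 Prop. 3.1.1 p. 455 L1–3, Remark p. 457 L4–13] [cite: Flath1979, Theorem 2 / Example 2] -/
theorem hirr_of_lemD1AsPrinted_row9 (F : CMField) (ι₁ : F →+* ℂ) (V : HermSpace3 F ι₁) (Φ : CMType F)
    (ε : Def411WeilCarriers.Eps ↥(maximalRealSubfield F) (imagUnitSq F))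
    (χ : Def411WeilCarriers.Chi ↥(maximalRealSubfield F) F (IsCMField.complexConj F))
    (𝓢 : LocalSplitting.FinLocalSplittings ↥(maximalRealSubfield F) F (IsCMField.complexConj F) (3 * 1) (complexConj_imagUnit F)
      (imagUnit_ne_zero F) (imagUnit_mul_self F)
      (gram ↥(maximalRealSubfield F) finProdFinEquiv (realDiagonal F V.diagEntries V.complexConj_diagEntries)
        (TW ↥(maximalRealSubfield F) (lineOf ↥(maximalRealSubfield F) (imagUnitSq F) ε)))
      (isSymm_gram ↥(maximalRealSubfield F) finProdFinEquiv (realDiagonal_isSymm F V.diagEntries V.complexConj_diagEntries)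
        (isSymm_TW ↥(maximalRealSubfield F) (lineOf ↥(maximalRealSubfield F) (imagUnitSq F) ε)))
      (reindex_kronecker_eq_gram_map ↥(maximalRealSubfield F) F finProdFinEquiv
        (realDiagonal_map F V.diagEntries V.complexConj_diagEntries).symm
        (JW_eq ↥(maximalRealSubfield F) F (lineOf ↥(maximalRealSubfield F) (imagUnitSq F) ε))))
    (hfac : (pairSmall₁ ↥(maximalRealSubfield F) F (IsCMField.complexConj F) 3 1 finProdFinEquiv (Matrix.diagonal V.diagEntries)
          (JW ↥(maximalRealSubfield F) F (lineOf ↥(maximalRealSubfield F) (imagUnitSq F) ε))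
          (OmegaMuSplitting.sMu F ι₁ V Φ (lineOf ↥(maximalRealSubfield F) (imagUnitSq F) ε))).comp
        (finPairToAdelic ↥(maximalRealSubfield F) F (IsCMField.complexConj F) 3 1 (Matrix.diagonal V.diagEntries)
          (JW ↥(maximalRealSubfield F) F (lineOf ↥(maximalRealSubfield F) (imagUnitSq F) ε))) =
      localRefSection ↥(maximalRealSubfield F) F (IsCMField.complexConj F) 3 1 finProdFinEquiv (Matrix.diagonal V.diagEntries)
        (JW ↥(maximalRealSubfield F) F (lineOf ↥(maximalRealSubfield F) (imagUnitSq F) ε)) (complexConj_imagUnit F) (imagUnit_ne_zero F)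
        (imagUnit_mul_self F) (realDiagonal_isSymm F V.diagEntries V.complexConj_diagEntries)
        (isSymm_TW ↥(maximalRealSubfield F) (lineOf ↥(maximalRealSubfield F) (imagUnitSq F) ε))
        (realDiagonal_map F V.diagEntries V.complexConj_diagEntries).symm
        (JW_eq ↥(maximalRealSubfield F) F (lineOf ↥(maximalRealSubfield F) (imagUnitSq F) ε)) 𝓢)
    (μ : ∀ v : HeightOneSpectrum (𝓞 ↥(maximalRealSubfield F)), (UnitaryGroup.LocalRing F v)ˣ →* ℂˣ)
    (hμn : ∀ v x, ‖((μ v x : ℂˣ) : ℂ)‖ = 1) (hμc : ∀ v, Continuous fun x => ((μ v x : ℂˣ) : ℂ))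
    (hμF : ∀ (v : HeightOneSpectrum (𝓞 ↥(maximalRealSubfield F))) (t : (v.adicCompletion ↥(maximalRealSubfield F))ˣ),
      μ v (Units.map (algebraMap (v.adicCompletion ↥(maximalRealSubfield F)) (UnitaryGroup.LocalRing F v)).toMonoidHom t) = 1 ↔
        ∃ x : (UnitaryGroup.LocalRing F v)ˣ, (x : UnitaryGroup.LocalRing F v) * UnitaryGroup.conjLocal F (IsCMField.complexConj F) v x =
          algebraMap (v.adicCompletion ↥(maximalRealSubfield F)) (UnitaryGroup.LocalRing F v) t)
    (hD1 : ∀ v, LemD1_1AsPrinted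
      (Def411WeilCarriers.localLemD1Data ↥(maximalRealSubfield F) F (IsCMField.complexConj F) 3 finProdFinEquiv (Matrix.diagonal V.diagEntries)
        (complexConj_imagUnit F) (imagUnit_ne_zero F) (imagUnit_mul_self F) (realDiagonal_isSymm F V.diagEntries V.complexConj_diagEntries)
        (isUnit_det_realDiagonal F V.diagEntries V.complexConj_diagEntries V.diagEntries_ne_zero)
        (realDiagonal_map F V.diagEntries V.complexConj_diagEntries).symm (lineOf ↥(maximalRealSubfield F) (imagUnitSq F) ε) 𝓢
        (le_of_eq (Nat.mul_one 3).symm) μ hμn hμc hμF χ.1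
        (Def411WeilCarriers.norm_chi_eq_one ↥(maximalRealSubfield F) F (IsCMField.complexConj F)
          (Algebra.IsQuadraticExtension.finrank_eq_two ↥(maximalRealSubfield F) F)
          (UnitaryGroup.algEquiv_ne_one_of_apply_eq_neg ↥(maximalRealSubfield F) F (IsCMField.complexConj F) (complexConj_imagUnit F)
            (imagUnit_ne_zero F)) χ)
        χ.2.1 v))
    (hS : ∃ S₁ : Finset (HeightOneSpectrum (𝓞 ↥(maximalRealSubfield F))), ∀ v ∉ S₁,
      TwistedCoinv.mk
        (show Representation ℂ (UnitaryGroup.localPi F (IsCMField.complexConj F) 1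
            (JW ↥(maximalRealSubfield F) F (lineOf ↥(maximalRealSubfield F) (imagUnitSq F) ε)) v) _ from
          (𝓢.omegaLoc v).comp (UnitaryGroup.localCenter F (IsCMField.complexConj F) (3 * 1)
            (Matrix.reindex finProdFinEquiv finProdFinEquiv
              (Matrix.diagonal V.diagEntries ⊗ₖ JW ↥(maximalRealSubfield F) F (lineOf ↥(maximalRealSubfield F) (imagUnitSq F) ε)))
            (JW ↥(maximalRealSubfield F) F (lineOf ↥(maximalRealSubfield F) (imagUnitSq F) ε))
            (JW_apply_ne_zero ↥(maximalRealSubfield F) F (lineOf ↥(maximalRealSubfield F) (imagUnitSq F) ε)) v))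
        (localCharOfCenter ↥(maximalRealSubfield F) F (IsCMField.complexConj F)
          (JW ↥(maximalRealSubfield F) F (lineOf ↥(maximalRealSubfield F) (imagUnitSq F) ε))
          (JW_apply_ne_zero ↥(maximalRealSubfield F) F (lineOf ↥(maximalRealSubfield F) (imagUnitSq F) ε)) χ.1 v)
        (unitVec ↥(maximalRealSubfield F) (Fin (3 * 1)) v) ≠ 0) :
    (Def411WeilCarriers.rho ↥(maximalRealSubfield F) F (IsCMField.complexConj F) 3 finProdFinEquiv (Matrix.diagonal V.diagEntries)
      (complexConj_imagUnit F) (imagUnit_ne_zero F) (imagUnit_mul_self F) (realDiagonal_isSymm F V.diagEntries V.complexConj_diagEntries)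
      (isUnit_det_realDiagonal F V.diagEntries V.complexConj_diagEntries V.diagEntries_ne_zero)
      (realDiagonal_map F V.diagEntries V.complexConj_diagEntries).symm (OmegaMuSplitting.hsMu F ι₁ V Φ)
      V.adelicFinDiag.toMulEquiv.toMonoidHom ε χ).IsIrreducible :=
  Def411WeilCarriers.rho_isIrreducible_of_lemD1AsPrinted ↥(maximalRealSubfield F) F (IsCMField.complexConj F) 3 finProdFinEquiv
    (Matrix.diagonal V.diagEntries) (complexConj_imagUnit F) (imagUnit_ne_zero F) (imagUnit_mul_self F)
    (realDiagonal_isSymm F V.diagEntries V.complexConj_diagEntries)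
    (isUnit_det_realDiagonal F V.diagEntries V.complexConj_diagEntries V.diagEntries_ne_zero)
    (realDiagonal_map F V.diagEntries V.complexConj_diagEntries).symm (OmegaMuSplitting.hsMu F ι₁ V Φ) ε χ 𝓢
    (ι := V.adelicFinDiag.toMulEquiv.toMonoidHom) (fun g => V.adelicFinDiag.toMulEquiv.surjective g) hfac
    (le_of_eq (Nat.mul_one 3).symm) μ hμn hμc hμF hD1 hS

end Summit.HodgeConjecture.CorCM.Model

end
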